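import Literature.NumberTheory.GaloisRepresentations.HOneUnramifiedProcyclic
import HarnessLib

/-!
# The unramified classes `ker(H¹(G, X) → H¹(N, X))` are FINITE when `X^N/(ψ − 1)X^N` is finite
# (`G ⊇ N·⟨ψ⟩` dense; "`H¹(Ẑ, A) = A/(φ − 1)A`", Serre *Local Fields* XIII §1 — the finiteness form)

Topic `NumberTheory/GaloisRepresentations`; namespace `Literature.NumberTheory.GaloisRepresentations`.
THEOREMS ONLY (no definition, no named fact, no `sorry`). Cell `bsd-stepL`, K2 support 20495
`JSWSigmaLocalCharIdeal` (module L5, step (S2) of `HOME/imc-p1/g13/L5-PLAN`); seat `bsd-stepL-imc-p1` g13.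

For a topological representation `X` of `G` with jointly continuous action and Hausdorff `X`, a subgroup
`N` (normal for the main statement) and `ψ ∈ G` with `N·⟨ψ⟩` dense in `G` (a decomposition group, its inertia
subgroup, a Frobenius lift), the tree's `HOneUnramifiedProcyclic` shows that an unramified class has an
`N`-vanishing representative `z`, that `z(ψ) ∈ X^N`, and that `[z] = [z']` iff `z(ψ) − z'(ψ) ∈ (ψ − 1)X^N`.
Hence `[z] ↦ z(ψ) mod (ψ − 1)X^N` is a well-defined INJECTION of `ker(res_N)` into `X^N/(ψ − 1)X^N`:

* **`finite_setOf_resSubgroup_eq_zero_of_finite_coinvariants`** — if the quotient of the `N`-invariants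
  `X^N` by the image of `ψ − 1` is finite, then `{c ∈ H¹(G, X) | res_N c = 0}` is finite.

This is the hypothesis `hker` of the tree's
`Literature.NumberTheory.EllipticCurves.moduleFinite_isTorsion_mem_charIdeal_dual_h1_of_finite_ker_res`
(the Greenberg–Vatsal Prop. 2.4 frame); at a finitely decomposed place it is supplied by
`BigRepModule.finite_quotient_range_shift_sub_id` when `E[p^∞]^{I_w}` is finite.

References: [SerreLocalFields1979] XIII §1 Prop. 1; [Rubin2000] Lemma 1.3.2, App. B §2;
[NeukirchSchmidtWingberg2008] (1.6.7); [GreenbergVatsal2000] Prop. 2.4.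
-/

noncomputable section

open scoped Classical Pointwise

open CategoryTheory

universe u v

namespace Literature.NumberTheory.GaloisRepresentations

open _root_.Subgroup

variable {R : Type u} [CommRing R] [TopologicalSpace R]
variable {G : Type v} [Group G] [TopologicalSpace G] [IsTopologicalGroup G]
variable (X : TopRep.{v} R G) [T2Space X] {N : Subgroup G} [N.Normal]

/-- **Finiteness of the unramified classes from the finiteness of the coinvariants `X^N/(ψ − 1)X^N`.**
Let `X` be a topological `G`-module with jointly continuous action, `N ⊴ G`, `ψ ∈ G` with `N·⟨ψ⟩` dense
in `G`, and `V = X^N` the `N`-invariants (an `R`-submodule stable under `ψ − 1`). If `V ⧸ (ψ − 1)V` is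
finite then `ker(res : H¹(G, X) → H¹(N, X))` is finite: `[z] ↦ z(ψ) mod (ψ − 1)V` (for an `N`-vanishing
representative `z`, `exists_rep_vanishing_of_resSubgroup_eq_zero`, `apply_mem_invariants_of_vanishing`) is
injective by `oneCocycleClass_eq_iff_of_vanishing`. [cite: SerreLocalFields1979, XIII §1 Prop. 1]
[cite: Rubin2000, Lemma 1.3.2] [cite: NeukirchSchmidtWingberg2008, (1.6.7)] -/
theorem finite_setOf_resSubgroup_eq_zero_of_finite_coinvariants
    (hXc : Continuous fun q : G × X => X.ρ q.1 q.2) {ψ : G}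
    (hdense : Dense ((N : Set G) * (zpowers ψ : Set G)))
    (V : Submodule R X) (hV : ∀ v : X, v ∈ V ↔ ∀ n : N, X.ρ (n : G) v = v)
    (hst : ∀ v ∈ V, (((X.ρ ψ).toLinearMap - LinearMap.id : (X : Type v) →ₗ[R] X)) v ∈ V)
    [Finite (V ⧸ LinearMap.range
      (((X.ρ ψ).toLinearMap - LinearMap.id : (X : Type v) →ₗ[R] X).restrict hst))] :
    Set.Finite {c : continuousCohomology 1 X | resSubgroup X N 1 c = 0} := by
  -- an `N`-vanishing representative for each unramified class, and its value at `ψ`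
  have hrep : ∀ c : {c : continuousCohomology 1 X | resSubgroup X N 1 c = 0},
      ∃ z : contOneCocycles X, oneCocycleClass X z = c.1 ∧ ∀ n : N, z.1 n = 0 :=
    fun c => exists_rep_vanishing_of_resSubgroup_eq_zero X hXc c.1 c.2
  choose z hz hzN using hrep
  have hzV : ∀ c, (z c).1 ψ ∈ V := fun c =>
    (hV _).mpr fun n => apply_mem_invariants_of_vanishing X (z c) (hzN c) ψ n
  -- the injection into `V ⧸ (ψ − 1)V`
  let key : {c : continuousCohomology 1 X | resSubgroup X N 1 c = 0} →
      V ⧸ LinearMap.range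
        (((X.ρ ψ).toLinearMap - LinearMap.id : (X : Type v) →ₗ[R] X).restrict hst) :=
    fun c => Submodule.Quotient.mk ⟨(z c).1 ψ, hzV c⟩
  haveI : Finite {c : continuousCohomology 1 X | resSubgroup X N 1 c = 0} := by
    refine Finite.of_injective key fun c c' hcc' => Subtype.ext ?_
    rw [← hz c, ← hz c']
    have h := (Submodule.Quotient.eq _).mp hcc'
    obtain ⟨⟨v, hvV⟩, hv⟩ := h
    have hv' : X.ρ ψ v - v = (z c).1 ψ - (z c').1 ψ := by
      have := congrArg Subtype.val hv
      simpa [LinearMap.restrict_apply, LinearMap.sub_apply, LinearMap.id_apply] using this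
    exact (oneCocycleClass_eq_iff_of_vanishing X hXc hdense (z c) (z c') (hzN c) (hzN c')).mpr
      ⟨v, (hV v).mp hvV, hv'.symm⟩
  exact Set.toFinite _

end Literature.NumberTheory.GaloisRepresentations

end
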